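import Summits.RiemannHypothesis.RiemannHypothesis.Theorems.WeilGroundStateGroundStatesConvergeToXiStubBoxSobolev
import Summits.RiemannHypothesis.RiemannHypothesis.Theorems.WeilGroundStateGroundStatesConvergeToXiStubPlancherelBudget
import Summits.RiemannHypothesis.RiemannHypothesis.Theorems.WeilGroundStateGroundStatesConvergeToXiStubZeroWindowCount
import HarnessLib

/-!
# Stub `stub_formBoundedSampling` of the line `Sketch` (crux `WeilGroundState.GroundStatesConvergeToXi`,
item stmt-RiemannHypothesis-1527, rev L9)

**The log-free, form-bounded sampling inequality at the zeta zeros (W10c).**  For every window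
`a > 0` there are `A, B ≥ 0` such that for every Weil test function `g` supported in `[-a, a]`
`Σ_ρ m(ρ) ‖ĝ(ρ)‖² ≤ A · Re Q(g) + B · ‖g‖₂²`, the series over the non-trivial zeros of `ζ`
(with multiplicity `m = riemannZetaZeroOrder`) being summable.  The two analytic inputs are taken
as hypotheses: (HA) the log-weighted assembly (window count + box samples + log-weighted line
budgets `⇒ Σ m(ρ)‖F ρ‖² ≤ 48 C₀ B`) and (HB) the form-bounded log-weighted line budgets of
`ĝ, (g y)^, (g y²)^` on `Re s = x ∈ [0, 1]`.

Assembly: `F = ĝ = weilMellin g` is entire with `F' = (g y)^`, `F'' = (g y²)^`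
(`stub_plancherelBudget`, `g ∈ L²` vanishing off the window); the samples
`‖F ρ‖² ≤ 4 ∫_{[k-1,k+1]} ∫_{[0,1]} (‖F‖² + 2‖F'‖² + ‖F''‖²)`, `k = round (Im ρ)`, come from
`stub_boxSobolev` (`0 < Re ρ < 1`, `|Im ρ - round (Im ρ)| ≤ 1/2`); the window count is
`stub_zeroWindowCount.1`; the three budgets of (HB) add up to `4 (A₁ Re Q(g) + B₁ ‖g‖₂²)`, and
(HA) gives the claim with `A = 48 C₀ · 4 A₁`, `B = 48 C₀ · 4 B₁`.
-/

set_option linter.dupNamespace false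

noncomputable section

open MeasureTheory Complex Filter Set
open scoped Real Topology ComplexConjugate

namespace Summit.RiemannHypothesis.RiemannHypothesis.Theorems.GroundStatesConvergeToXi

open Literature.NumberTheory.LFunctions

/-- Adding three weighted line budgets: if `fᵢ w` are integrable with `∫ fᵢ w ≤ R` (`i = 0,1,2`),
then `(f₀ + 2 f₁ + f₂) w` is integrable with integral `≤ 4 R`. [folklore] -/
theorem formSampling_budget {f₀ f₁ f₂ w : ℝ → ℝ} {R : ℝ}
    (h0 : Integrable fun t => f₀ t * w t) (h1 : Integrable fun t => f₁ t * w t)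
    (h2 : Integrable fun t => f₂ t * w t)
    (b0 : ∫ t, f₀ t * w t ≤ R) (b1 : ∫ t, f₁ t * w t ≤ R) (b2 : ∫ t, f₂ t * w t ≤ R) :
    Integrable (fun t => (f₀ t + 2 * f₁ t + f₂ t) * w t) ∧
      ∫ t, (f₀ t + 2 * f₁ t + f₂ t) * w t ≤ 4 * R := by
  have e : (fun t => (f₀ t + 2 * f₁ t + f₂ t) * w t) =
      fun t => (f₀ t * w t + 2 * (f₁ t * w t)) + f₂ t * w t := by
    funext t; ring
  rw [e]
  refine ⟨(h0.add (h1.const_mul 2)).add h2, ?_⟩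
  have e1 : ∫ t, (f₀ t * w t + 2 * (f₁ t * w t)) + f₂ t * w t =
      (∫ t, (f₀ t * w t + 2 * (f₁ t * w t))) + ∫ t, f₂ t * w t :=
    integral_add (h0.add (h1.const_mul 2)) h2
  have e2 : ∫ t, (f₀ t * w t + 2 * (f₁ t * w t)) = (∫ t, f₀ t * w t) + ∫ t, 2 * (f₁ t * w t) :=
    integral_add h0 (h1.const_mul 2)
  have e3 : ∫ t, 2 * (f₁ t * w t) = 2 * ∫ t, f₁ t * w t := integral_const_mul 2 _
  rw [e1, e2, e3]
  linarith

/-- **Stub W10c — `formBoundedSampling` (RH-free; THE LOG-FREE SAMPLING INEQUALITY IN FORM NORM;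
takes W10a's and W10b's conclusions as hypotheses).**  For every window `a > 0` there are
`A, B ≥ 0` with `Σ_ρ m(ρ)‖ĝ(ρ)‖² ≤ A·Re Q(g) + B·‖g‖₂²`, summably, for every test function `g`
supported in `[-a,a]` — the zero-sampling map `T_a g = (ĝ(ρ))_ρ` is FORM-BOUNDED (under RH,
`Q = T*T` by the explicit formula; this is the RH-free half).  Assembly: `F = ĝ` entire with
`F' = (gt)^`, `F'' = (gt²)^` (`stub_plancherelBudget`), samples from `stub_boxSobolev` at
`τ = round(Im ρ)`, window count `stub_zeroWindowCount.1`, budgets `B = 4(A·Re Q(g) + B·‖g‖²)`.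
[folklore] -/
theorem stub_formBoundedSampling :
    (∀ (C₀ B : ℝ) (F F₁ F₂ : ℂ → ℂ), 0 ≤ C₀ →
      (∀ (τ : ℝ) (T : Finset ℂ),
        (∀ ρ ∈ T, ρ ∈ ZetaZeros.riemannZetaNontrivialZeros ∧ |ρ.im - τ| ≤ 1 / 2) →
          ∑ ρ ∈ T, (riemannZetaZeroOrder ρ : ℝ) ≤ C₀ * Real.log (|τ| + 2)) →
      Continuous F → Continuous F₁ → Continuous F₂ →
      (∀ x ∈ Icc (0 : ℝ) 1, Integrable fun t : ℝ =>
        (‖F (x + t * I)‖ ^ 2 + 2 * ‖F₁ (x + t * I)‖ ^ 2 + ‖F₂ (x + t * I)‖ ^ 2) *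
          Real.log (|t| + 2)) →
      (∀ x ∈ Icc (0 : ℝ) 1, ∫ t : ℝ,
        (‖F (x + t * I)‖ ^ 2 + 2 * ‖F₁ (x + t * I)‖ ^ 2 + ‖F₂ (x + t * I)‖ ^ 2) *
          Real.log (|t| + 2) ≤ B) →
      (∀ ρ ∈ ZetaZeros.riemannZetaNontrivialZeros,
        ‖F ρ‖ ^ 2 ≤ 4 * ∫ t in Icc ((round ρ.im : ℝ) - 1) ((round ρ.im : ℝ) + 1),
          ∫ x in Icc (0 : ℝ) 1,
            (‖F (x + t * I)‖ ^ 2 + 2 * ‖F₁ (x + t * I)‖ ^ 2 + ‖F₂ (x + t * I)‖ ^ 2)) →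
      Summable (fun ρ : ZetaZeros.riemannZetaNontrivialZeros =>
          (riemannZetaZeroOrder (ρ : ℂ) : ℝ) * ‖F ρ‖ ^ 2) ∧
        ∑' ρ : ZetaZeros.riemannZetaNontrivialZeros,
            (riemannZetaZeroOrder (ρ : ℂ) : ℝ) * ‖F ρ‖ ^ 2 ≤ 48 * C₀ * B) →
    (∀ a : ℝ, 0 < a → ∃ A B : ℝ, 0 ≤ A ∧ 0 ≤ B ∧ ∀ g : ℝ → ℂ, IsWeilTest g →
      tsupport g ⊆ Icc (-a) a → ∀ n : ℕ, n ≤ 2 → ∀ x : ℝ, x ∈ Icc (0 : ℝ) 1 →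
        Integrable (fun t : ℝ =>
          ‖weilMellin (fun y : ℝ => g y * (y : ℂ) ^ n) (x + t * I)‖ ^ 2 * Real.log (|t| + 2)) ∧
        ∫ t : ℝ, ‖weilMellin (fun y : ℝ => g y * (y : ℂ) ^ n) (x + t * I)‖ ^ 2 *
            Real.log (|t| + 2) ≤
          A * (weilQuadratic g).re + B * ∫ t : ℝ, ‖g t‖ ^ 2) →
    ∀ a : ℝ, 0 < a → ∃ A B : ℝ, 0 ≤ A ∧ 0 ≤ B ∧ ∀ g : ℝ → ℂ, IsWeilTest g →
      tsupport g ⊆ Icc (-a) a →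
        Summable (fun ρ : ZetaZeros.riemannZetaNontrivialZeros =>
          (riemannZetaZeroOrder (ρ : ℂ) : ℝ) * ‖weilMellin g ρ‖ ^ 2) ∧
        ∑' ρ : ZetaZeros.riemannZetaNontrivialZeros,
            (riemannZetaZeroOrder (ρ : ℂ) : ℝ) * ‖weilMellin g ρ‖ ^ 2 ≤
          A * (weilQuadratic g).re + B * ∫ t : ℝ, ‖g t‖ ^ 2 := by
  intro HA HB a ha
  obtain ⟨A₁, B₁, hA₁, hB₁, hbud⟩ := HB a ha
  obtain ⟨C₀, hC₀, hcount⟩ := stub_zeroWindowCount.1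
  refine ⟨48 * C₀ * (4 * A₁), 48 * C₀ * (4 * B₁), by positivity, by positivity,
    fun g hg hsupp => ?_⟩
  -- `g ∈ L²` vanishes off the window, so `ĝ = weilMellin g` is entire with `ĝ⁽ⁿ⁾ = (g yⁿ)^`
  have hmem : MemLp g 2 volume := hg.1.continuous.memLp_of_hasCompactSupport hg.2
  have hae : ∀ᵐ t : ℝ, t ∉ Icc (-a) a → g t = 0 :=
    ae_of_all _ fun t ht => image_eq_zero_of_notMem_tsupport fun h => ht (hsupp h)
  obtain ⟨hdiff, hder, -⟩ := stub_plancherelBudget a g ha hmem hae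
  have hF1 : deriv (weilMellin g) = weilMellin (fun y : ℝ => g y * (y : ℂ) ^ 1) := by
    have h := hder 1; rw [iteratedDeriv_one] at h; exact h
  have hF2 : deriv (deriv (weilMellin g)) = weilMellin (fun y : ℝ => g y * (y : ℂ) ^ 2) := by
    have h := hder 2; rw [iteratedDeriv_succ, iteratedDeriv_one] at h; exact h
  have hF0 : weilMellin (fun y : ℝ => g y * (y : ℂ) ^ 0) = weilMellin g := by
    rw [← hder 0, iteratedDeriv_zero]
  have hdF : Differentiable ℂ (deriv (weilMellin g)) := hdiff.deriv
  have hddF : Differentiable ℂ (deriv (deriv (weilMellin g))) := hdF.deriv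
  have hc0 : Continuous (weilMellin g) := hdiff.continuous
  have hc1 : Continuous (weilMellin (fun y : ℝ => g y * (y : ℂ) ^ 1)) := hF1 ▸ hdF.continuous
  have hc2 : Continuous (weilMellin (fun y : ℝ => g y * (y : ℂ) ^ 2)) := hF2 ▸ hddF.continuous
  -- the box-Sobolev samples at the zeros
  have hsample : ∀ ρ ∈ ZetaZeros.riemannZetaNontrivialZeros,
      ‖weilMellin g ρ‖ ^ 2 ≤ 4 * ∫ t in Icc ((round ρ.im : ℝ) - 1) ((round ρ.im : ℝ) + 1),
        ∫ x in Icc (0 : ℝ) 1,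
          (‖weilMellin g (x + t * I)‖ ^ 2 +
            2 * ‖weilMellin (fun y : ℝ => g y * (y : ℂ) ^ 1) (x + t * I)‖ ^ 2 +
            ‖weilMellin (fun y : ℝ => g y * (y : ℂ) ^ 2) (x + t * I)‖ ^ 2) := by
    intro ρ hρ
    have hβ : ρ.re ∈ Icc (0 : ℝ) 1 :=
      ⟨(ZetaZeros.riemannZetaNontrivialZeros.re_pos hρ).le,
        (ZetaZeros.riemannZetaNontrivialZeros.re_lt_one hρ).le⟩
    have h := stub_boxSobolev (weilMellin g) hdiff ρ.re ρ.im (round ρ.im) hβ (abs_sub_round ρ.im)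
    rw [re_add_im, hF2, hF1] at h
    exact h
  -- the log-weighted line budgets, added up
  have hΦ : ∀ x ∈ Icc (0 : ℝ) 1,
      Integrable (fun t : ℝ => (‖weilMellin g (x + t * I)‖ ^ 2 +
        2 * ‖weilMellin (fun y : ℝ => g y * (y : ℂ) ^ 1) (x + t * I)‖ ^ 2 +
        ‖weilMellin (fun y : ℝ => g y * (y : ℂ) ^ 2) (x + t * I)‖ ^ 2) * Real.log (|t| + 2)) ∧
      ∫ t : ℝ, (‖weilMellin g (x + t * I)‖ ^ 2 +
        2 * ‖weilMellin (fun y : ℝ => g y * (y : ℂ) ^ 1) (x + t * I)‖ ^ 2 +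
        ‖weilMellin (fun y : ℝ => g y * (y : ℂ) ^ 2) (x + t * I)‖ ^ 2) * Real.log (|t| + 2) ≤
        4 * (A₁ * (weilQuadratic g).re + B₁ * ∫ t : ℝ, ‖g t‖ ^ 2) := by
    intro x hx
    obtain ⟨h0i, h0b⟩ := hbud g hg hsupp 0 (by norm_num) x hx
    obtain ⟨h1i, h1b⟩ := hbud g hg hsupp 1 (by norm_num) x hx
    obtain ⟨h2i, h2b⟩ := hbud g hg hsupp 2 le_rfl x hx
    rw [hF0] at h0i h0b
    exact formSampling_budget h0i h1i h2i h0b h1b h2b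
  have key := HA C₀ (4 * (A₁ * (weilQuadratic g).re + B₁ * ∫ t : ℝ, ‖g t‖ ^ 2))
    (weilMellin g) (weilMellin (fun y : ℝ => g y * (y : ℂ) ^ 1))
    (weilMellin (fun y : ℝ => g y * (y : ℂ) ^ 2)) hC₀.le hcount hc0 hc1 hc2
    (fun x hx => (hΦ x hx).1) (fun x hx => (hΦ x hx).2) hsample
  refine ⟨key.1, key.2.trans_eq ?_⟩
  ring

end Summit.RiemannHypothesis.RiemannHypothesis.Theorems.GroundStatesConvergeToXi

end
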